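import Literature.MathematicalPhysics.QuantumFieldTheory.Balaban1983to89.B8Prop6CubeMemberFlat3Gamma
import Literature.MathematicalPhysics.QuantumFieldTheory.Balaban1983to89.B8Thm4ExistsAtGammaG

/-!
# `Balaban1983to89.B8Prop6CubeMemberFlat3GammaG` — [Balaban1985RegularSpaces] PROPOSITION 6 (p. 99) AT THE CONCRETE CUBE MEMBER, MODULO THE THREE
# EXISTENCE BODIES AT THE FLAT DATUM `(1, U₀″)`, EDITION γ, **WITH `G`-VALUED GAUGE TRANSFORMATIONS** (print p. 76 «G = SU(N)»):
# `B8Prop6CubeMemberFlat3Gamma.prop6_exists_cubeMember_at_γ₃` re-run over `B8Thm4ExistsAtGammaG.thm4Exists_concrete_at_γ_mem`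

statement-level skeleton of published theorems with citation tags; proofs where landed; nothing here is a claim about the
Yang–Mills mass gap

T. Bałaban, *Spaces of regular gauge field configurations on a lattice and gauge fixing conditions*, Commun. Math. Phys. **99** (1985) 75–102
`[Balaban1985RegularSpaces]` ("B8"): Prop. 6 (1.135)–(1.136) p. 99, p. 98 (the local axial gauge `v`), Thm 4 p. 88, Prop. 5 (1.107)–(1.108) p. 94, (1.58)–(1.59)
p. 86, (1.31) p. 82, p. 76 («we consider … G = SU(N)»); T. Bałaban, *Propagators and renormalization transformations … II*, CMP **96** (1984) 223–250
`[Balaban1984PropagatorsII]` (2.3) p. 224; T. Bałaban, *Averaging operations for lattice gauge theories*, CMP **98** (1985) 17–51 `[Balaban1985Averaging]`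
(42)–(43) pp. 23–24 (averaging-closed `G`).  STATUS: published, refereed.

CITATION HEADER (lean-in-tree rule).  Cell `pub-ymgap` (HUMAN RULING D-0062, Track A), DAG node N05 = [B8], seat `pub-ymgap-dag-n05-e` g33 (Prop-6 γ-crown authoring
lineage), CROSS-CELL SERVICE for cell `ym3-torus` (LEAD-H ★ym-ust-19200-w5 g6, line H-P6J of crux stmt-QuantumFields-19200; pub-ymgap bus XCELL-1∕2, INTENT-G1):
file (F2) of the `G`-valued re-run of this seat's γ chain.  WHAT IS REPRODUCED.  ★ `prop6_exists_cubeMember_at_γ₃_mem` — `B8Prop6CubeMemberFlat3Gamma.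
prop6_exists_cubeMember_at_γ₃` (this seat, g10) VERBATIM (statement and proof) except: an averaging-closed subgroup `G ≤ U(𝔸)` is a parameter
(`(hGA : AvgClosed d L G) (hGu : G ≤ unitaryUnits 𝔸)`), the configuration `U₀` is `G`-VALUED, the two Proposition-5 bodies ask for ∕ deliver `G`-valued `v` (the
step body may assume `u₁ ∈ G`), and the conclusion carries `∀ x, u x ∈ G` AND `∀ x, (v⁻¹u)(x) ∈ G` for print's local axial gauge `v = localGauge …` of p. 98 —
`G`-valued by dag-n05-a's `B8Prop6OfThm4.localGauge_mem … (hG : AvgClosed d L G)` (already `G`-generic).  Driver: (F1) `B8Thm4ExistsAtGammaG.thm4Exists_concrete_at_γ_mem`.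
By-name twin; no new analysis.  Kind «kernel-checked proof», theorems only: no `def`, no `… : Prop` fact, no `instance`, no `notation`, no existing module modified.
`--supports stmt-QuantumFields-19200` (ym3-torus's crux; count-neutral for both cells).

HONEST SCOPE ∕ A6.  Exactly as `B8Prop6CubeMemberFlat3Gamma`: the three bodies are HYPOTHESES at the flat datum; nothing of [B8] asserted; N05's Track-A status
untouched; rung R3 is ym3-torus's and NOT Clay; pub-ymgap = one finite 𝕋⁴ programme at fixed ε; nothing continuum ∕ ℝ⁴ ∕ OS ∕ mass-gap ∕ Clay.  No `sorry`, no `def`.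
-/

noncomputable section

open NormedSpace

namespace Literature.MathematicalPhysics.QuantumFieldTheory.Balaban1983to89.B8Prop6CubeMemberFlat3GammaG

open B7Prop1Explicit B7Prop2Explicit B7Prop1Local B7Eq92Concrete B8Ineq130
open B7Prop2Explicit (C0 c2')
open B8Ineq132 (covDerivFwd InAk pdevOn_lt_of_inAk BondTouches)
open B8Ineq133 (cutFixed)
open B8Eq115GaugeFixing (localGauge)
open B8Eq119TwistedAxial (InAx Restr129)
open B8Eq184Proof (gaugeExp cfgExp)
open B8Lemma1NonAbelian (mulCfg)
open B8Eq140Level (SideTouches)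
open B8Eq146AExpansion (iEta)
open B7Prop4GeneralLevels (linCovIter)
open B8Eq155JBound (Jcur wsup)
open B8ScaledSupNorm (bondNorm msup)
open B8Thm2LogB (blockTop)
open B8Eq138LandauZd (IsLandau138W logCfg)
open B8Eq131Cubes (tcube tLo tHi ctr tLo_le_tHi)
open B8Eq131CubesAdmissible (cubeFam)
open B8Prop6OfThm4 (localGauge_mem agree135 smallness_134 const_136)
open B8CubeMemberZd (cubeLamS cubeLamB hΩ_cubeFam hbox_cubeLamB hclass_cubeLamB)
open B8Prop6CubeMember (regime_of_printed_smallness)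
open B8Ineq133CubeMemberGamma (thm4_hypotheses_one_cutFixed_γ)
open B9SupplySockB9P3ZdGamma (cubeLamBP')
open B8CubeMemberLamBPrimeLaws (cubeLamBP'_hbox_pred cubeLamBP'_hclass)
open B8Thm4ExistsAtGammaG (thm4Exists_concrete_at_γ_mem)
open B8LeafKnitZd3CubBdryBeta (bdryLayer_cubeMember)
open B9SupplySockB9P3ZdBeta (CrossB)

export B7Prop1Explicit (Site)

variable {d : ℕ}

variable {𝔸 : Type} [CStarAlgebra 𝔸] [Nontrivial 𝔸]

/-- ★ **PROPOSITION 6 (p. 99) AT THE CONCRETE CUBE MEMBER, MODULO THE THREE EXISTENCE BODIES AT THE FLAT DATUM `(1, U₀″)`, EDITION γ, `G`-VALUED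
GAUGE TRANSFORMATIONS** — `B8Prop6CubeMemberFlat3Gamma.prop6_exists_cubeMember_at_γ₃` VERBATIM except: `G ≤ U(𝔸)` averaging-closed is a parameter, `U₀` is
`G`-valued, Proposition 5's two bodies ask for ∕ deliver `G`-valued `v` (the step body may assume `u₁ ∈ G`), and the conclusion carries `u ∈ G` and
`w = v⁻¹u ∈ G` (`v = localGauge …`, print's p. 98 local axial gauge, `G`-valued by `B8Prop6OfThm4.localGauge_mem` under `AvgClosed d L G` and `U₀ ∈ G`).  Print
p. 76: «we consider … G = SU(N)».  Driver (F1) `thm4Exists_concrete_at_γ_mem`; datum dictionary `thm4_hypotheses_one_cutFixed_γ`, class laws `cubeLamBP'_hbox_pred` ∕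
`cubeLamBP'_hclass`, `bdryLayer_cubeMember` as in the unitary edition.
[cite: Balaban1985RegularSpaces, Prop. 6 (1.135)–(1.136) p.99, p.98, p.99 (sentence after (1.133)), Thm 4 p.88 (existence), Prop. 5 (1.107)–(1.108) p.94, (1.58)–(1.59) p.86, (1.31) p.82, p.76; Balaban1984PropagatorsII, (2.3) p.224; Balaban1985Averaging, (42)–(43) pp.23–24] -/
theorem prop6_exists_cubeMember_at_γ₃_mem (hd2 : 2 ≤ d) {L : ℕ} (hL : 2 ≤ L) {G : Subgroup 𝔸ˣ} (hGA : AvgClosed d L G) (hGu : G ≤ unitaryUnits 𝔸)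
    {B₀ B₀' Bbd : ℝ} (hB₀ : 0 < B₀) (hB₀' : 0 < B₀')
    (hB : 2 ≤ 5 * (d : ℝ) * L * B₀) (hBbd : 0 ≤ Bbd) (hBd : 4 * Bbd ≤ ((d : ℝ) * L - 1) * B₀) :
    ∃ c₁ : ℝ, 0 < c₁ ∧ ∀ (η : ℝ), 0 < η → ∀ (k : ℕ), 1 ≤ k → ∀ (a : Site d) (M ρ : ℕ), L ≤ ρ → ρ ≤ M → 11 * (d : ℝ) < M →
      ∀ (U₀ : Site d → Fin d → 𝔸ˣ), (∀ x κ, U₀ x κ ∈ G) → ∀ (α₀ : ℝ), 0 < α₀ →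
      C0 d * (α₀ * (L : ℝ) ^ 2) ≤ 1 / 3 → 2 * (α₀ * (L : ℝ) ^ 2) ≤ c2' d L →
      ∀ (Ω : ℕ → Set (Site d)), InAk L k η α₀ Ω U₀ → tcube L a M ρ k ⊆ Ω (k - 1) →
      11 * (d : ℝ) ^ 2 * (L : ℝ) ^ 2 * α₀ + ((M : ℝ) + 4 * ρ) * d * (L : ℝ) ^ 2 * α₀ ≤ 1 / 6 →
      (L : ℝ) ^ 3 * α₀ + 6 * d * (L : ℝ) ^ 2 * M * α₀ ≤ c₁ →
      ((∃ (v : Site d → 𝔸ˣ) (lam : Site d → 𝔸), (∀ x, v x ∈ G) ∧ (∀ x, x ∉ (cubeFam false L a M ρ k) 0 → v x = 1) ∧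
        (∀ j, j ≤ 1 → ∀ b ∈ {b : Site d × Fin d | SideTouches ((cubeFam false L a M ρ k) j) b.1 b.2}, (v b.1 : 𝔸) = ((gaugeExp lam b.1 : 𝔸ˣ) : 𝔸) ∧
        (v (b.1 + e b.2) : 𝔸) = ((gaugeExp lam (b.1 + e b.2) : 𝔸ˣ) : 𝔸)) ∧
        (∀ j, j ≤ 1 → ∀ b ∈ {b : Site d × Fin d | SideTouches ((cubeFam false L a M ρ k) j) b.1 b.2},
        ‖lam b.1‖ ≤ (8 * B₀' * (5 * (d : ℝ) * L * B₀) * (((L : ℝ) ^ 3 * α₀) + (6 * d * (L : ℝ) ^ 2 * M * α₀))) ∧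
          ((L : ℝ) ^ j * η) * ‖covDerivFwd η (1 : Site d → Fin d →
          𝔸ˣ) b.2 lam b.1‖ ≤ (8 * B₀' * (5 * (d : ℝ) * L * B₀) * (((L : ℝ) ^ 3 * α₀) + (6 * d * (L : ℝ) ^ 2 * M * α₀)))) ∧
        IsLandau138W L 1 η ((cubeFam false L a M ρ k) 0) ((cubeLamS L a M ρ k) 1) (1 : Site d → Fin d → 𝔸ˣ) (mgauge (1 : Site d → Fin d →
          𝔸ˣ) v⁻¹ (cutFixed L (tLo a ρ) (tHi a M ρ) U₀ k (ctr a M))) ∧ Restr129 L 1 ((cubeLamS L a M ρ k) 1) (1 : Site d → Fin d → 𝔸ˣ) ((1 : Site d →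
          𝔸ˣ) * v))) →
      ((∀ m, 1 ≤ m → m < k → ∀ (u₁ : Site d → 𝔸ˣ) (U₁ : Site d → Fin d → 𝔸ˣ) (A : Site d → Fin d → 𝔸),
        (∀ x, u₁ x ∈ G) → (∀ x, x ∉ (cubeFam false L a M ρ k) 0 → u₁ x = 1) → mgauge (1 : Site d → Fin d →
          𝔸ˣ) u₁ U₁ = (cutFixed L (tLo a ρ) (tHi a M ρ) U₀ k (ctr a M)) → Restr129 L m ((cubeLamS L a M ρ k) m) (1 : Site d → Fin d → 𝔸ˣ) u₁ →
        IsLandau138W L m η ((cubeFam false L a M ρ k) 0) ((cubeLamS L a M ρ k) m) (1 : Site d → Fin d → 𝔸ˣ) U₁ →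
        (∀ j, j ≤ m → ∀ b ∈ {b : Site d × Fin d | SideTouches ((cubeFam false L a M ρ k) j) b.1 b.2},
        U₁ b.1 b.2 = cfgExp η A b.1 b.2 ∧ IsSelfAdjoint (A b.1 b.2) ∧
          ‖A b.1 b.2‖ ≤ (5 * (d : ℝ) * L * B₀ * (((L : ℝ) ^ 3 * α₀) + (6 * d * (L : ℝ) ^ 2 * M * α₀))) * ((L : ℝ) ^ j * η)⁻¹) →
        ∃ (v : Site d → 𝔸ˣ) (lam : Site d → 𝔸), (∀ x, v x ∈ G) ∧ (∀ x, x ∉ (cubeFam false L a M ρ k) 0 → v x = 1) ∧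
        (∀ j, j ≤ m + 1 →
          ∀ b ∈ {b : Site d × Fin d | SideTouches ((cubeFam false L a M ρ k) j) b.1 b.2}, (v b.1 : 𝔸) = ((gaugeExp lam b.1 : 𝔸ˣ) : 𝔸) ∧
        (v (b.1 + e b.2) : 𝔸) = ((gaugeExp lam (b.1 + e b.2) : 𝔸ˣ) : 𝔸)) ∧
        (∀ j, j ≤ m + 1 → ∀ b ∈ {b : Site d × Fin d | SideTouches ((cubeFam false L a M ρ k) j) b.1 b.2},
        ‖lam b.1‖ ≤ (8 * B₀' * (5 * (d : ℝ) * L * B₀) * (((L : ℝ) ^ 3 * α₀) + (6 * d * (L : ℝ) ^ 2 * M * α₀))) ∧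
          ((L : ℝ) ^ j * η) * ‖covDerivFwd η (1 : Site d → Fin d →
          𝔸ˣ) b.2 lam b.1‖ ≤ (8 * B₀' * (5 * (d : ℝ) * L * B₀) * (((L : ℝ) ^ 3 * α₀) + (6 * d * (L : ℝ) ^ 2 * M * α₀)))) ∧
        IsLandau138W L (m + 1) η ((cubeFam false L a M ρ k) 0) ((cubeLamS L a M ρ k) (m + 1)) (1 : Site d → Fin d → 𝔸ˣ) (mgauge (1 : Site d → Fin d →
          𝔸ˣ) v⁻¹ U₁) ∧ Restr129 L (m + 1) ((cubeLamS L a M ρ k) (m + 1)) (1 : Site d → Fin d → 𝔸ˣ) (u₁ * v))) →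
      ((∀ m, 1 ≤ m → m ≤ k → ∀ (u : Site d → 𝔸ˣ) (W : Site d → Fin d → 𝔸ˣ) (A' : Site d → Fin d → 𝔸),
        (∀ x, u x ∈ unitaryUnits 𝔸) → (∀ x, x ∉ (cubeFam false L a M ρ k) 0 → u x = 1) →
          mgauge (1 : Site d → Fin d → 𝔸ˣ) u W = (cutFixed L (tLo a ρ) (tHi a M ρ) U₀ k (ctr a M)) →
          Restr129 L m ((cubeLamS L a M ρ k) m) (1 : Site d → Fin d → 𝔸ˣ) u →
          IsLandau138W L m η ((cubeFam false L a M ρ k) 0) ((cubeLamS L a M ρ k) m) (1 : Site d → Fin d → 𝔸ˣ) W →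
        (∀ y τ, IsSelfAdjoint (A' y τ)) →
        (∀ j, j ≤ m → ∀ y τ, SideTouches ((cubeFam false L a M ρ k) j) y τ →
        W y τ = cfgExp η A' y τ ∧
          ‖A' y τ‖ ≤ (2 * (L * (5 * (d : ℝ) * L * B₀ * (((L : ℝ) ^ 3 * α₀) + (6 * d * (L : ℝ) ^ 2 * M * α₀)))) + 8 * (8 * B₀' * (5 * (d : ℝ) * L * B₀) * (((L : ℝ) ^ 3 * α₀) + (6 * d * (L : ℝ) ^ 2 * M * α₀)))) * ((L : ℝ) ^ j * η)⁻¹) →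
        (∀ y τ, (∀ j, j ≤ m → ¬ SideTouches ((cubeFam false L a M ρ k) j) y τ) → A' y τ = 0) →
        msup L m η (-(1 : ℝ)) (fun j (b : Site d × Fin d) => SideTouches ((cubeFam false L a M ρ k) j) b.1 b.2) (fun b => A' b.1 b.2)
        ≤ B₀ * (bondNorm L m η (-(3 : ℝ)) (cubeFam false L a M ρ k) (fun x μ => Jcur η (1 : Site d → Fin d → 𝔸ˣ) A' μ x)
        + wsup 1 (fun p : {p : ℕ × (Site d × Fin d) // p.1 ≤ m ∧ (p.2 ∈ (cubeLamBP' L a M ρ k) m p.1 ∨ (p.1 = 0 ∧ CrossB ((cubeFam false L a M ρ k) 0) p.2))} =>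
        linCovIter L (1 : Site d → Fin d → 𝔸ˣ) (iEta η A') p.1.1 p.1.2.1 p.1.2.2))
        + Bbd * msup L m η (-(1 : ℝ)) (fun j (b : Site d × Fin d) => j = 0 ∧ SideTouches ((cubeFam false L a M ρ k) 0) b.1 b.2 ∧
            ¬ BondTouches ((cubeFam false L a M ρ k) 0) b.1 b.2) (fun b => A' b.1 b.2) ∧
        msup L m η (-(2 : ℝ)) (fun j (t : Fin d × Fin d × Site d) => SideTouches ((cubeFam false L a M ρ k) j) t.2.2 t.2.1)
        (fun t => covDerivFwd η (1 : Site d → Fin d → 𝔸ˣ) t.1 (fun z => A' z t.2.1) t.2.2)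
        ≤ B₀ * (bondNorm L m η (-(3 : ℝ)) (cubeFam false L a M ρ k) (fun x μ => Jcur η (1 : Site d → Fin d → 𝔸ˣ) A' μ x)
        + wsup 1 (fun p : {p : ℕ × (Site d × Fin d) // p.1 ≤ m ∧ (p.2 ∈ (cubeLamBP' L a M ρ k) m p.1 ∨ (p.1 = 0 ∧ CrossB ((cubeFam false L a M ρ k) 0) p.2))} =>
        linCovIter L (1 : Site d → Fin d → 𝔸ˣ) (iEta η A') p.1.1 p.1.2.1 p.1.2.2))
        + Bbd * msup L m η (-(1 : ℝ)) (fun j (b : Site d × Fin d) => j = 0 ∧ SideTouches ((cubeFam false L a M ρ k) 0) b.1 b.2 ∧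
            ¬ BondTouches ((cubeFam false L a M ρ k) 0) b.1 b.2) (fun b => A' b.1 b.2))) →
      ∃ u : Site d → 𝔸ˣ, (∀ x, u x ∈ G) ∧ (∀ x, x ∉ cubeFam false L a M ρ k 0 → u x = 1) ∧
        Restr129 L k (cubeLamS L a M ρ k k) (1 : Site d → Fin d → 𝔸ˣ) u ∧
        IsLandau138W L k η (cubeFam false L a M ρ k 0) (cubeLamS L a M ρ k k) (1 : Site d → Fin d → 𝔸ˣ)
          (gaugeAct u⁻¹ (cutFixed L (tLo a ρ) (tHi a M ρ) U₀ k (ctr a M))) ∧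
        (∀ j, j ≤ k → ∀ b ∈ {b : Site d × Fin d | SideTouches (cubeFam false L a M ρ k j) b.1 b.2},
          gaugeAct u⁻¹ (cutFixed L (tLo a ρ) (tHi a M ρ) U₀ k (ctr a M)) b.1 b.2 =
              cfgExp η (logCfg η (gaugeAct u⁻¹ (cutFixed L (tLo a ρ) (tHi a M ρ) U₀ k (ctr a M)))) b.1 b.2 ∧
            IsSelfAdjoint (logCfg η (gaugeAct u⁻¹ (cutFixed L (tLo a ρ) (tHi a M ρ) U₀ k (ctr a M))) b.1 b.2) ∧
            ‖logCfg η (gaugeAct u⁻¹ (cutFixed L (tLo a ρ) (tHi a M ρ) U₀ k (ctr a M))) b.1 b.2‖ ≤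
              (5 * (d : ℝ) * L * B₀ * ((L : ℝ) ^ 3 * α₀ + 6 * d * (L : ℝ) ^ 2 * M * α₀)) * ((L : ℝ) ^ j * η)⁻¹) ∧
        (∀ x, ((localGauge L (tLo a ρ) (tHi a M ρ) U₀ k (ctr a M))⁻¹ * u) x ∈ G) ∧
        AgreeOn (tlo L (tLo a ρ) k) (thi L (tHi a M ρ) k)
          (gaugeAct ((localGauge L (tLo a ρ) (tHi a M ρ) U₀ k (ctr a M))⁻¹ * u)⁻¹ U₀)
          (gaugeAct u⁻¹ (cutFixed L (tLo a ρ) (tHi a M ρ) U₀ k (ctr a M))) := by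
  have hL1 : 1 ≤ L := le_trans (by norm_num) hL
  have hd1 : 1 ≤ d := le_trans (by norm_num) hd2
  obtain ⟨c₁, hc₁, H⟩ := thm4Exists_concrete_at_γ_mem (𝔸 := 𝔸) hd2 hL G hGu hB₀ hB₀' hB hBbd hBd
  refine ⟨c₁, hc₁, ?_⟩
  intro η hη k hk a M ρ hρL hρM hM U₀ hU₀G α₀ hα hα3 hα2 Ω hA hT hsmall hc P5base₁ P5step₁ H59Dβ₁
  have hU₀ : ∀ x κ, U₀ x κ ∈ unitaryUnits 𝔸 := fun x κ => hGu (hU₀G x κ)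
  have hρ : 1 ≤ ρ := hL1.trans hρL
  have hM1 : 1 ≤ M := hρ.trans hρM
  have hLpos : (0 : ℝ) < L := by exact_mod_cast lt_of_lt_of_le (by norm_num) hL
  have hdpos : (0 : ℝ) < d := by exact_mod_cast hd1
  have hMpos : (0 : ℝ) < M := by exact_mod_cast hM1
  have hα₀' : 0 < (L : ℝ) ^ 3 * α₀ := by positivity
  have hα₁' : 0 < 6 * (d : ℝ) * (L : ℝ) ^ 2 * M * α₀ := by positivity
  obtain ⟨hmem, h33, h34, hAx, h135, h66⟩ :=
    thm4_hypotheses_one_cutFixed_γ L hL hd1 k U₀ hU₀ hα hα3 hα2 a hρ hρM hM hη hA hT hsmall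
  have hone : ∀ x κ, (1 : Site d → Fin d → 𝔸ˣ) x κ ∈ unitaryUnits 𝔸 := fun _ _ => (unitaryUnits 𝔸).one_mem
  obtain ⟨u, hu, huS, h129, hLan, h162⟩ := H η hη k (cubeFam false L a M ρ k) (hΩ_cubeFam hL1 a M hρL k)
    (cubeLamS L a M ρ k) (cubeLamBP' L a M ρ k) (cubeLamBP'_hbox_pred hL1 a M hρL k) (cubeLamBP'_hclass hL1 a M hρL k)
    (bdryLayer_cubeMember hL a M ρ k hρL hk) _ _ hα₀' hα₁' hc 1 _ hone hmem h33 h34 hAx h135 h66 P5base₁ P5step₁ H59Dβ₁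
  simp only [mgauge_one_left] at hLan h162
  have hΩ' : ∃ l, l ≤ k ∧ k ≤ l + 1 ∧ ∀ x, InBox (tlo L (tLo a ρ) k) (thi L (tHi a M ρ) k) x → x ∈ Ω l :=
    ⟨k - 1, Nat.sub_le _ _, by omega, fun x hx => hT hx⟩
  have hvG : ∀ x, localGauge L (tLo a ρ) (tHi a M ρ) U₀ k (ctr a M) x ∈ G :=
    localGauge_mem L hL hGA k U₀ hU₀G hα hα3 hα2 (tLo_le_tHi hM1) (pdevOn_lt_of_inAk hL1 hα hA hΩ') (ctr a M)
  exact ⟨u, hu, huS, h129, hLan hk, h162, fun x => G.mul_mem (G.inv_mem (hvG x)) (hu x), agree135 _ _ U₀ _ u⟩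

#print axioms prop6_exists_cubeMember_at_γ₃_mem

end Literature.MathematicalPhysics.QuantumFieldTheory.Balaban1983to89.B8Prop6CubeMemberFlat3GammaG

end
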